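import Mathlib
import Summits.ValiantsHypothesis.ValiantsHypothesis.Theorems.LacunarySymmetroidMatrixDescartesGramDualCoherent
import Summits.ValiantsHypothesis.ValiantsHypothesis.Theorems.LacunarySymmetroidMatrixDescartesGramDualInertiaDuality
import Summits.ValiantsHypothesis.ValiantsHypothesis.Theorems.LacunarySymmetroidMatrixDescartesQuasiDefiniteCone
import Summits.ValiantsHypothesis.ValiantsHypothesis.Theorems.LacunarySymmetroidMatrixDescartesInertiaKit

/-!
# `MatrixDescartes` (stmt-ValiantsHypothesis-18050) — FROZEN INERTIA on the sterile sectors: a quasi-definite pencil has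
# inertia `(|P|, |N|)` at every positive scale, and a word on the sign-coherent Gram sector has the inertia OF ITS BASE
# LETTER at every positive scale

HONEST FRAMING.  Cell `pub-symmetroid`, seat `val-sym-mdr-p2` (gen 20); helper file `--supports` the crux
`Theses.LacunarySymmetroid.MatrixDescartes` (OPEN), NO closure claim; companion of `…QuasiDefiniteCone` (the cone law:
`Z₊ = 0`) and `…GramDualCoherent` (the sign-coherent Gram law: `Z₊ = 0`), through the inertia kit `…InertiaKit` and the
INERTIA DUALITY of `…GramDualInertiaDuality` (`ν(F(x)) + #{σ>0} = ν(B) + π(𝔻(x))`, `π(F(x)) + #{σ<0} = π(B) + ν(𝔻(x))`).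
STRUCTURE statements («sterile = the inertia never moves»); nothing here bears on the crux in its window, `stub_twoSided`,
`DoorA26` / `DoorA34`, registers, or `VP ≠ VNP`.

* `posIndex_eq_card_of_quasiDefinite` / `negIndex_eq_card_of_quasiDefinite` — a real symmetric matrix that is positive
  definite on the `P`-supported vectors and negative definite on the vectors supported off `P` has EXACTLY `|P|` positive
  and `|ι| − |P|` negative eigenvalues (coordinate families are definite families: `Inertia.card_le_posIndex`,
  `card_le_negIndex`; the count `ν + π ≤ |ι|` closes the sandwich).
* **`inertia_pencil_eq_of_quasiDefinite` (FROZEN INERTIA ON THE CONE).**  On the quasi-definite cone of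
  `…QuasiDefiniteCone` (letters `⪰ 0` on `P`-supported vectors, `⪯ 0` off `P`, jointly strict on each side) the evaluated
  pencil `Σ_l x^{d_l}S_l` has `π = |P|` and `ν = |ι| − |P|` for EVERY `x > 0` — the inertia walk is constant (hence no
  zero, and no inertia event at all), whatever the exponents.
* **`inertia_word_eq_base_of_coherent` (FROZEN INERTIA ON THE COHERENT SECTOR).**  `B` symmetric non-degenerate, signs
  `σⱼ ≠ 0`, Gram matrix `UᵀB⁻¹U` PSD on the positive columns and NSD on the negative ones: for every `x > 0`,
  `ν(x^eB + U diag(σⱼx^{δⱼ}) Uᵀ) = ν(B)` and `π(…) = π(B)` — coherent letters NEVER MOVE THE INERTIA OF THE BASE, at any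
  scale, any exponents, any size (the dual `diag(σ⁻¹x^{E−δ}) + x^{E−e}C` is quasi-definite for `sgn σ`, so
  `π(𝔻(x)) = #{σ>0}`, `ν(𝔻(x)) = #{σ<0}`, and the inertia duality transports this to the word).
  PSD-letter form `inertia_word_eq_base_of_posSemidef_gram` (all `σⱼ > 0`, Gram `⪰ 0`).
READING.  The one-sided rung freezes nothing (the inertia walks monotonically from `In(S_bot)` to `In(S_top)` and every
step is a zero); the sterile sectors are exactly where the walk cannot start: In is pinned to the base (coherent) or to
the splitting (cone).  The located quantitative question — `k` incoherent columns confine `ν(F(x))` to a band of width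
`k` around `ν(B)`; does a band bound the number of zeros? — is NOT claimed (revivals inside a band are unbounded a
priori; cf. `…InertiaGlobalIndex`).

[folklore] (Sylvester's law of inertia; quasi-definite matrices).  Axioms `propext`, `Classical.choice`, `Quot.sound`.
-/

-- layout Summits/ValiantsHypothesis/ValiantsHypothesis forces the duplicated namespace component
set_option linter.dupNamespace false

namespace Summit.ValiantsHypothesis.ValiantsHypothesis.Theorems.LacunarySymmetroidMatrixDescartes

open Polynomial Matrix Finset
open scoped BigOperators

namespace QuasiDefinite

variable {ι : Type} [Fintype ι] [DecidableEq ι]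

/-! ## §1  The inertia of a quasi-definite matrix -/

/-- A combination of coordinate vectors indexed by `{i // P i}` is supported on `P`, and vanishes only for zero
coefficients. [folklore] -/
theorem sum_smul_single_apply (P : ι → Prop) [DecidablePred P] (c : {i // P i} → ℝ) (j : ι) :
    (∑ a : {i // P i}, c a • (Pi.single (a.1 : ι) (1 : ℝ) : ι → ℝ)) j = if h : P j then c ⟨j, h⟩ else 0 := by
  rw [Finset.sum_apply]
  simp only [Pi.smul_apply, smul_eq_mul, Pi.single_apply, mul_ite, mul_one, mul_zero]
  split_ifs with hj
  · rw [Finset.sum_eq_single (⟨j, hj⟩ : {i // P i})]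
    · rw [if_pos rfl]
    · intro a _ ha
      rw [if_neg (show ¬ (j = (a.1 : ι)) from fun h => ha (Subtype.ext h.symm))]
    · intro h
      exact absurd (Finset.mem_univ _) h
  · refine Finset.sum_eq_zero fun a _ => ?_
    rw [if_neg (show ¬ (j = (a.1 : ι)) from fun h => hj (h ▸ a.2))]

/-- **π of a quasi-definite matrix is `|P|`** and **ν is `|ι| − |P|`**: a real symmetric matrix positive definite on the
`P`-supported vectors and negative definite on the vectors supported off `P`. [folklore] -/
theorem posIndex_eq_card_of_quasiDefinite {M : Matrix ι ι ℝ} (hM : M.IsHermitian) (P : ι → Prop) [DecidablePred P]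
    (hP : ∀ v : ι → ℝ, (∀ i, ¬ P i → v i = 0) → v ≠ 0 → 0 < v ⬝ᵥ (M *ᵥ v))
    (hN : ∀ v : ι → ℝ, (∀ i, P i → v i = 0) → v ≠ 0 → v ⬝ᵥ (M *ᵥ v) < 0) :
    Fintype.card {j // 0 < hM.eigenvalues j} = Fintype.card {i // P i}
      ∧ Fintype.card {j // hM.eigenvalues j < 0} = Fintype.card {i // ¬ P i} := by
  classical
  -- the positive coordinate family
  have hpos : Fintype.card {i // P i} ≤ Fintype.card {j // 0 < hM.eigenvalues j} := by
    refine Inertia.card_le_posIndex hM (fun a : {i // P i} => (Pi.single (a.1 : ι) (1 : ℝ) : ι → ℝ)) fun c hc => ?_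
    refine hP _ (fun j hj => ?_) ?_
    · rw [sum_smul_single_apply, dif_neg hj]
    · intro h0
      apply hc
      funext a
      have := congrFun h0 a.1
      rw [sum_smul_single_apply, dif_pos a.2, Pi.zero_apply] at this
      exact this
  -- the negative coordinate family
  have hneg : Fintype.card {i // ¬ P i} ≤ Fintype.card {j // hM.eigenvalues j < 0} := by
    refine Inertia.card_le_negIndex hM (fun a : {i // ¬ P i} => (Pi.single (a.1 : ι) (1 : ℝ) : ι → ℝ)) fun c hc => ?_
    refine hN _ (fun j hj => ?_) ?_
    · rw [sum_smul_single_apply (fun i => ¬ P i), dif_neg (not_not.2 hj)]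
    · intro h0
      apply hc
      funext a
      have := congrFun h0 a.1
      rw [sum_smul_single_apply (fun i => ¬ P i), dif_pos a.2, Pi.zero_apply] at this
      exact this
  -- the sandwich `π + ν ≤ |ι| = |P| + |¬P|`
  have hcount := (Inertia.negIndex_add_posIndex_add_corank hM).1
  have hsplit : Fintype.card {i // P i} + Fintype.card {i // ¬ P i} = Fintype.card ι := by
    rw [Fintype.card_subtype_compl, Nat.add_sub_cancel' (Fintype.card_subtype_le _)]
  constructor <;> omega

/-! ## §2  Frozen inertia on the quasi-definite cone -/

section Pencil

variable {K : ℕ}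

omit [Fintype ι] [DecidableEq ι] in
/-- The evaluated pencil of symmetric letters is hermitian. [folklore] -/
theorem isHermitian_eval_pencil (d : Fin K → ℕ) (S : Fin K → Matrix ι ι ℝ) (hS : ∀ l, (S l).IsSymm) (x : ℝ) :
    (∑ l, x ^ d l • S l).IsHermitian :=
  Inertia.isHermitian_of_isSymm (isSymm_eval_pencil d S hS x)

/-- **FROZEN INERTIA ON THE CONE.**  On the quasi-definite cone (letters `⪰ 0` on `P`-supported vectors, `⪯ 0` off `P`,
jointly strict on each side), for every `x > 0` the evaluated pencil `Σ_l x^{d_l} S_l` has exactly `|P|` positive and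
`|ι| − |P|` negative eigenvalues. [folklore] -/
theorem inertia_pencil_eq_of_quasiDefinite (d : Fin K → ℕ) (S : Fin K → Matrix ι ι ℝ)
    (hS : ∀ l, (S l).IsSymm) (P : ι → Prop) [DecidablePred P]
    (hP : ∀ l (v : ι → ℝ), (∀ i, ¬ P i → v i = 0) → 0 ≤ v ⬝ᵥ (S l *ᵥ v))
    (hN : ∀ l (v : ι → ℝ), (∀ i, P i → v i = 0) → v ⬝ᵥ (S l *ᵥ v) ≤ 0)
    (hP' : ∀ v : ι → ℝ, (∀ i, ¬ P i → v i = 0) → v ≠ 0 → ∃ l, 0 < v ⬝ᵥ (S l *ᵥ v))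
    (hN' : ∀ v : ι → ℝ, (∀ i, P i → v i = 0) → v ≠ 0 → ∃ l, v ⬝ᵥ (S l *ᵥ v) < 0)
    {x : ℝ} (hx : 0 < x) :
    Fintype.card {j // 0 < (isHermitian_eval_pencil d S hS x).eigenvalues j} = Fintype.card {i // P i}
      ∧ Fintype.card {j // (isHermitian_eval_pencil d S hS x).eigenvalues j < 0} = Fintype.card {i // ¬ P i} := by
  refine posIndex_eq_card_of_quasiDefinite _ P (fun v hv hv0 => ?_) (fun v hv hv0 => ?_)
  · obtain ⟨l₁, hl₁⟩ := hP' v hv hv0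
    rw [form_pencil]
    calc (0 : ℝ) < x ^ d l₁ * (v ⬝ᵥ (S l₁ *ᵥ v)) := mul_pos (pow_pos hx _) hl₁
      _ ≤ ∑ l, x ^ d l * (v ⬝ᵥ (S l *ᵥ v)) :=
          Finset.single_le_sum (f := fun l => x ^ d l * (v ⬝ᵥ (S l *ᵥ v)))
            (fun l _ => mul_nonneg (pow_pos hx _).le (hP l v hv)) (Finset.mem_univ l₁)
  · obtain ⟨l₁, hl₁⟩ := hN' v hv hv0
    rw [form_pencil]
    have hle : ∀ l ∈ (Finset.univ : Finset (Fin K)), x ^ d l * (v ⬝ᵥ (S l *ᵥ v)) ≤ 0 :=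
      fun l _ => mul_nonpos_of_nonneg_of_nonpos (pow_pos hx _).le (hN l v hv)
    have hlt : x ^ d l₁ * (v ⬝ᵥ (S l₁ *ᵥ v)) < 0 := mul_neg_of_pos_of_neg (pow_pos hx _) hl₁
    calc ∑ l, x ^ d l * (v ⬝ᵥ (S l *ᵥ v))
        = x ^ d l₁ * (v ⬝ᵥ (S l₁ *ᵥ v)) + ∑ l ∈ Finset.univ.erase l₁, x ^ d l * (v ⬝ᵥ (S l *ᵥ v)) :=
          (Finset.add_sum_erase _ _ (Finset.mem_univ l₁)).symm
      _ < 0 + 0 := add_lt_add_of_lt_of_le hlt (Finset.sum_nonpos fun l hl => hle l (Finset.mem_univ l))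
      _ = 0 := add_zero 0

end Pencil

end QuasiDefinite

/-! ## §3  Frozen inertia on the sign-coherent Gram sector: the word has the inertia of its base -/

namespace GramDual

variable {ι ρ : Type} [Fintype ι] [DecidableEq ι] [Fintype ρ] [DecidableEq ρ]

omit [Fintype ι] [DecidableEq ι] in
/-- The evaluated signed word is hermitian for a symmetric base. [folklore] -/
theorem isHermitian_eval_word {B : Matrix ι ι ℝ} (hBs : B.IsSymm) (U : Matrix ι ρ ℝ) (σ : ρ → ℝ) (e : ℕ)
    (δ : ρ → ℕ) (x : ℝ) : (x ^ e • B + U * Matrix.diagonal (fun j => σ j * x ^ δ j) * Uᵀ).IsHermitian := by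
  refine Inertia.isHermitian_of_isSymm (Matrix.IsSymm.add (hBs.smul _) ?_)
  unfold Matrix.IsSymm
  rw [Matrix.transpose_mul, Matrix.transpose_mul, Matrix.transpose_transpose, Matrix.diagonal_transpose,
    Matrix.mul_assoc]

omit [Fintype ρ] in
/-- The evaluated dual word is hermitian for a symmetric base. [folklore] -/
theorem isHermitian_eval_dual {B : Matrix ι ι ℝ} (hBs : B.IsSymm) (U : Matrix ι ρ ℝ) (σ : ρ → ℝ) (E e : ℕ)
    (δ : ρ → ℕ) (x : ℝ) :
    (Matrix.diagonal (fun j => (σ j)⁻¹ * x ^ (E - δ j)) + x ^ (E - e) • (Uᵀ * B⁻¹ * U)).IsHermitian :=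
  Inertia.isHermitian_of_isSymm ((Matrix.isSymm_diagonal _).add ((isSymm_gram hBs U).smul _))

/-- **The dual of a coherent word is quasi-definite for `sgn σ`: `π(𝔻(x)) = #{σ > 0}`, `ν(𝔻(x)) = #{σ < 0}`.** [folklore] -/
theorem inertia_dual_eq_of_coherent {B : Matrix ι ι ℝ} (hBs : B.IsSymm) (U : Matrix ι ρ ℝ) (σ : ρ → ℝ)
    (hσ : ∀ j, σ j ≠ 0) (E e : ℕ) (δ : ρ → ℕ)
    (hP : ∀ v : ρ → ℝ, (∀ j, σ j < 0 → v j = 0) → 0 ≤ v ⬝ᵥ ((Uᵀ * B⁻¹ * U) *ᵥ v))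
    (hN : ∀ v : ρ → ℝ, (∀ j, 0 < σ j → v j = 0) → v ⬝ᵥ ((Uᵀ * B⁻¹ * U) *ᵥ v) ≤ 0)
    {x : ℝ} (hx : 0 < x) :
    Fintype.card {j // 0 < (isHermitian_eval_dual hBs U σ E e δ x).eigenvalues j} = Fintype.card {j // 0 < σ j}
      ∧ Fintype.card {j // (isHermitian_eval_dual hBs U σ E e δ x).eigenvalues j < 0}
        = Fintype.card {j // ¬ 0 < σ j} := by
  classical
  have hdiag : ∀ v : ρ → ℝ, v ⬝ᵥ ((Matrix.diagonal (fun j => (σ j)⁻¹ * x ^ (E - δ j))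
      + x ^ (E - e) • (Uᵀ * B⁻¹ * U)) *ᵥ v)
      = (∑ j, (σ j)⁻¹ * x ^ (E - δ j) * v j ^ 2) + x ^ (E - e) * (v ⬝ᵥ ((Uᵀ * B⁻¹ * U) *ᵥ v)) := by
    intro v
    rw [Matrix.add_mulVec, dotProduct_add, Matrix.smul_mulVec, dotProduct_smul, smul_eq_mul]
    congr 1
    rw [dotProduct]
    refine Finset.sum_congr rfl fun j _ => ?_
    rw [Matrix.mulVec_diagonal]
    ring
  refine QuasiDefinite.posIndex_eq_card_of_quasiDefinite _ (fun j => 0 < σ j) (fun v hv hv0 => ?_) (fun v hv hv0 => ?_)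
  · -- supported on the positive columns: the diagonal part is a positive sum, the Gram part is `≥ 0`
    rw [hdiag]
    have hgram : 0 ≤ x ^ (E - e) * (v ⬝ᵥ ((Uᵀ * B⁻¹ * U) *ᵥ v)) :=
      mul_nonneg (pow_pos hx _).le (hP v fun j hj => hv j (not_lt.2 hj.le))
    have hnonneg : ∀ j ∈ (Finset.univ : Finset ρ), 0 ≤ (σ j)⁻¹ * x ^ (E - δ j) * v j ^ 2 := by
      intro j _
      by_cases hj : 0 < σ j
      · exact mul_nonneg (mul_nonneg (inv_pos.2 hj).le (pow_pos hx _).le) (sq_nonneg _)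
      · rw [hv j hj]; simp
    obtain ⟨j₀, hj₀⟩ : ∃ j, v j ≠ 0 := by
      by_contra h
      push Not at h
      exact hv0 (funext h)
    have hj₀P : 0 < σ j₀ := by
      by_contra h
      exact hj₀ (hv j₀ h)
    have hterm : 0 < (σ j₀)⁻¹ * x ^ (E - δ j₀) * v j₀ ^ 2 :=
      mul_pos (mul_pos (inv_pos.2 hj₀P) (pow_pos hx _)) (by positivity)
    have hsum : 0 < ∑ j, (σ j)⁻¹ * x ^ (E - δ j) * v j ^ 2 :=
      lt_of_lt_of_le hterm (Finset.single_le_sum hnonneg (Finset.mem_univ j₀))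
    linarith
  · -- supported on the negative columns
    rw [hdiag]
    have hvN : ∀ j, σ j < 0 ∨ v j = 0 := fun j => by
      by_cases hj : 0 < σ j
      · exact Or.inr (hv j hj)
      · exact Or.inl (lt_of_le_of_ne (not_lt.1 hj) (hσ j))
    have hgram : x ^ (E - e) * (v ⬝ᵥ ((Uᵀ * B⁻¹ * U) *ᵥ v)) ≤ 0 :=
      mul_nonpos_of_nonneg_of_nonpos (pow_pos hx _).le (hN v fun j hj => hv j hj)
    have hnonpos : ∀ j ∈ (Finset.univ : Finset ρ), (σ j)⁻¹ * x ^ (E - δ j) * v j ^ 2 ≤ 0 := by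
      intro j _
      rcases hvN j with hj | hj
      · exact mul_nonpos_of_nonpos_of_nonneg (mul_nonpos_of_nonpos_of_nonneg (inv_lt_zero.2 hj).le (pow_pos hx _).le)
          (sq_nonneg _)
      · rw [hj]; simp
    obtain ⟨j₀, hj₀⟩ : ∃ j, v j ≠ 0 := by
      by_contra h
      push Not at h
      exact hv0 (funext h)
    have hj₀N : σ j₀ < 0 := (hvN j₀).resolve_right hj₀
    have hterm : (σ j₀)⁻¹ * x ^ (E - δ j₀) * v j₀ ^ 2 < 0 :=
      mul_neg_of_neg_of_pos (mul_neg_of_neg_of_pos (inv_lt_zero.2 hj₀N) (pow_pos hx _)) (by positivity)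
    have hsum : ∑ j, (σ j)⁻¹ * x ^ (E - δ j) * v j ^ 2 < 0 := by
      calc ∑ j, (σ j)⁻¹ * x ^ (E - δ j) * v j ^ 2
          = (σ j₀)⁻¹ * x ^ (E - δ j₀) * v j₀ ^ 2
            + ∑ j ∈ Finset.univ.erase j₀, (σ j)⁻¹ * x ^ (E - δ j) * v j ^ 2 :=
            (Finset.add_sum_erase _ _ (Finset.mem_univ j₀)).symm
        _ < 0 + 0 := add_lt_add_of_lt_of_le hterm (Finset.sum_nonpos fun j _ => hnonpos j (Finset.mem_univ j))
        _ = 0 := add_zero 0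
    linarith

/-- **FROZEN INERTIA ON THE COHERENT SECTOR.**  `B` real symmetric with `det B ≠ 0`, signs `σⱼ ≠ 0`, exponents arbitrary,
Gram matrix PSD on the positive columns and NSD on the negative columns: at EVERY `x > 0` the word
`x^eB + U diag(σⱼx^{δⱼ}) Uᵀ` has `ν = ν(B)` and `π = π(B)` — coherent letters never move the inertia of the base.
[folklore] -/
theorem inertia_word_eq_base_of_coherent {B : Matrix ι ι ℝ} (hBs : B.IsSymm) (hBu : IsUnit B.det) (U : Matrix ι ρ ℝ)
    (σ : ρ → ℝ) (hσ : ∀ j, σ j ≠ 0) (e : ℕ) (δ : ρ → ℕ)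
    (hP : ∀ v : ρ → ℝ, (∀ j, σ j < 0 → v j = 0) → 0 ≤ v ⬝ᵥ ((Uᵀ * B⁻¹ * U) *ᵥ v))
    (hN : ∀ v : ρ → ℝ, (∀ j, 0 < σ j → v j = 0) → v ⬝ᵥ ((Uᵀ * B⁻¹ * U) *ᵥ v) ≤ 0)
    {x : ℝ} (hx : 0 < x) (hB : B.IsHermitian) :
    Fintype.card {j // (isHermitian_eval_word hBs U σ e δ x).eigenvalues j < 0}
        = Fintype.card {j // hB.eigenvalues j < 0}
      ∧ Fintype.card {j // 0 < (isHermitian_eval_word hBs U σ e δ x).eigenvalues j}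
        = Fintype.card {j // 0 < hB.eigenvalues j} := by
  classical
  obtain ⟨E, he, hδ⟩ := exists_bound e δ
  have hdual := inertia_dual_eq_of_coherent hBs U σ hσ E e δ hP hN hx
  have hν := negIndex_word_add_eq hBs hBu U σ hσ e E δ he hδ hx hB (isHermitian_eval_word hBs U σ e δ x)
    (isHermitian_eval_dual hBs U σ E e δ x)
  have hπ := posIndex_word_add_eq hBs hBu U σ hσ e E δ he hδ hx hB (isHermitian_eval_word hBs U σ e δ x)
    (isHermitian_eval_dual hBs U σ E e δ x)
  rw [hdual.1] at hν
  rw [hdual.2] at hπ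
  have hneg : Fintype.card {j // σ j < 0} = Fintype.card {j // ¬ 0 < σ j} := by
    refine Fintype.card_congr (Equiv.subtypeEquivRight fun j => ?_)
    exact ⟨fun h => not_lt.2 h.le, fun h => lt_of_le_of_ne (not_lt.1 h) (hσ j)⟩
  rw [hneg] at hπ
  constructor <;> omega

/-- **PSD letters with PSD Gram matrix never move the inertia of the base**: all `σⱼ > 0`, `UᵀB⁻¹U ⪰ 0` ⇒
`In(x^eB + U diag(σx^δ)Uᵀ) = In(B)` for every `x > 0`. [folklore] -/
theorem inertia_word_eq_base_of_posSemidef_gram {B : Matrix ι ι ℝ} (hBs : B.IsSymm) (hBu : IsUnit B.det)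
    (U : Matrix ι ρ ℝ) (σ : ρ → ℝ) (hσ : ∀ j, 0 < σ j) (e : ℕ) (δ : ρ → ℕ) (hC : (Uᵀ * B⁻¹ * U).PosSemidef)
    {x : ℝ} (hx : 0 < x) (hB : B.IsHermitian) :
    Fintype.card {j // (isHermitian_eval_word hBs U σ e δ x).eigenvalues j < 0}
        = Fintype.card {j // hB.eigenvalues j < 0}
      ∧ Fintype.card {j // 0 < (isHermitian_eval_word hBs U σ e δ x).eigenvalues j}
        = Fintype.card {j // 0 < hB.eigenvalues j} := by
  refine inertia_word_eq_base_of_coherent hBs hBu U σ (fun j => (hσ j).ne') e δ (fun v _ => ?_) (fun v hv => ?_) hx hB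
  · simpa only [star_trivial] using hC.dotProduct_mulVec_nonneg v
  · have hv0 : v = 0 := funext fun j => hv j (hσ j)
    rw [hv0, Matrix.mulVec_zero, dotProduct_zero]

end GramDual

end Summit.ValiantsHypothesis.ValiantsHypothesis.Theorems.LacunarySymmetroidMatrixDescartes
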